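import Mathlib.Data.Nat.Log
import Mathlib.LinearAlgebra.Matrix.Hermitian
import Literature.Computability.Complexity.Promise
import Literature.Computability.Complexity.BoolEncodings
import Literature.Computability.QuantumComplexity.PauliExpansion
import Literature.Computability.QuantumComplexity.PauliParseval
import HarnessLib

/-!
# The guided Pauli-Hamiltonian promise problem `GLH(K, χ₀)`

The *guided local Hamiltonian problem with semi-classical guiding vector* of Gharibian–Le Gall
[GharibianLegall2022, §1.2, box `GLH*(k, a, b, δ)`, and Thm 2]:

> Input: a `k`-local Hamiltonian `H` acting on `n` qubits such that `‖H‖ ≤ 1`, and the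
> description of a semi-classical state `u ∈ ℂ^{2ⁿ}` (a subset state `|S|^{-1/2} Σ_{w ∈ S} |w⟩`
> with `|S| = poly(n)`, given as the list `S`).  Promises: (i) `‖Π_H u‖ ≥ δ` (`Π_H` = projector
> onto the ground space); (ii) either `λ_H ≤ a` or `λ_H ≥ b`.  Goal: decide which.

packaged as ONE `Literature.Computability.Complexity.PromiseProblem` over `{0,1}` in the explicit
instance format used (inlined, twice) by route `NeedleThreshold` of the summit `QuantumAdvantage`
(items `GuidedHardness`, `NeedleBPP`), so that hardness and membership facts can be filed against
a name.  The format and its five deliberate deltas from the printed box are: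

* an instance is `⟨n, (terms, (guide, (α, (β, D))))⟩ : GuidedPauliInstance` — a qubit number `n`,
  weighted Pauli terms (`GuidedPauliTerm n`), a guide list, threshold data `α β : ℤ`, `D : ℕ` —
  encoded over `Bool` by `guidedPauliEncoding` (the tree's `sigmaBool / pairBool / listBool`
  combinators over `encodingIntBool`, `encodingBitVec n`, `encodingBoolBool`, `encodingNatBool`);
* a term `((p, q), (x, z))` denotes `(p + q√2) • ⊗ᵢ σ(xᵢ, zᵢ)` with the symplectic letter map
  `(0,0) ↦ I, (1,0) ↦ X, (0,1) ↦ Z, (1,1) ↦ Y` (`Pauli.ofXZ`, `termString`) and a real weight in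
  `ℤ[√2]` (`termWeight`); `H = Σ_t (p_t + q_t√2) • ⊗ᵢ σ(x_{t,i}, z_{t,i})`
  (`guidedPauliHamiltonian`) and `Λ = Σ_t |p_t + q_t√2|` is its **Pauli 1-norm** (`pauliOneNorm`,
  the `κ = Σ ‖H_i‖` of an `(s, κ)`-decomposition [Gall2024, §1.4 and §2.3], as `‖⊗σ‖ = 1`).
  Delta (i): energies are measured relative to `Λ` (thresholds `aΛ`, `bΛ`) instead of assuming
  `‖H‖ ≤ 1`; delta (iii): NO `k`-locality is imposed on the strings;
* the guide is the **signed subset state** `u = Σ_{(s, x) ∈ guide} (−1)^s e_x`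
  (`signedSubsetState`, unnormalised; repeated entries add up).  Delta (ii): signs are allowed,
  versus the subset states of Grilo–Kerenidis–Sikora used in [GharibianLegall2022, §1.2];
* thresholds `a = α/(D+1) < b = β/(D+1)`; the promise common to both sides is `0 < Λ` and
  `(D+1) ≤ (β − α) · g(n)`, i.e. a RELATIVE promise gap `b − a ≥ 1/g(n)`, for a precision
  schedule `g : ℕ → ℝ` (`guidedPauliProblem g χ₀`).  Delta (v): the route's problem
  `guidedPauliHamiltonianProblem K χ₀` FIXES `g(n) = K ⌊log₂ n⌋² + 1` (precision `1/log² n`); the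
  sibling `guidedPauliHamiltonianProblem' c χ₀` fixes `g(n) = n^c + c` (precision `1/poly(n)`, the
  regime of [GharibianLegall2022, Thm 2], whose transcription is to be filed against it);
* YES (`IsGuidedPauliYes`, `guidedPauliYesSet`): `u ≠ 0` and there are `l : ℝ` and `v ≠ 0` with
  `H v = l v`, `l (D+1) ≤ α Λ` (an eigenvalue `≤ aΛ`) and `χ₀² ‖u‖² ‖v‖² ≤ |⟨u, v⟩|²` (overlap
  `≥ χ₀` after normalising both); NO (`IsGuidedPauliNo`, `guidedPauliNoSet`): every eigenpair
  `(l, v)` has `β Λ ≤ l (D+1)` (`spec H ≥ bΛ`).  Delta (iv): the overlap promise is only on the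
  YES side and is phrased through ONE eigenvector at energy `≤ aΛ` rather than through `Π_H`.

API: `guidedPauliHamiltonianProblem_eq` — unfolding, by `rfl`, to the term inlined verbatim in
the route items (so both can be restated by name with `Iff.rfl`); `mk_mem_guidedPauliYesSet_iff`,
`mk_mem_guidedPauliNoSet_iff` (membership of an explicit instance = the predicate on its data);
`guidedPauliProblem_disjoint`, `guidedPauliHamiltonianProblem_disjoint`, `…'_disjoint` (for a
non-negative schedule YES ∩ NO = ∅: `Λ > 0` and the gap force `α < β`);
`isHermitian_guidedPauliHamiltonian` (real weights on Hermitian strings, so the real "eigenvalues"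
`l` above exhaust the spectrum).

Deliberately NOT here: the hardness theorem [GharibianLegall2022, Thm 2] (BQP-hardness of
`GLH*(6, a, b, δ)` for `b − a = Ω(1/poly)`, `δ < 1/√2 − Ω(1/poly)`) and the classical algorithms
[GharibianLegall2022, Thm 1; Gall2024] are separate (cite) facts about these objects; no
`k`-locality predicate; no `ℓ²`-normalised version of the guide.

## References

* [GharibianLegall2022] S. Gharibian, F. Le Gall, *Dequantizing the quantum singular value
  transformation: hardness and applications to quantum chemistry and the quantum PCP
  conjecture*, STOC 2022, 19–32 (arXiv:2111.09079), §1.2 (boxes `GLH(k, ε, δ)`,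
  `GLH*(k, a, b, δ)`; semi-classical subset states), Thm 2.
* [Gall2024] F. Le Gall, *Classical algorithms for constant approximation of the ground state
  energy of local Hamiltonians*, arXiv:2410.21833 (ESA 2025), §1.4, §2.3 (`(s, κ)`-decompositions).
* [AaronsonGottesman2004] S. Aaronson, D. Gottesman, Phys. Rev. A 70 (2004), §III (`x, z` bits).
* [AroraBarak2009] S. Arora, B. Barak, *Computational Complexity*, §0.1 (encodings).

## Mathlib / tree search

`lean search 'guided|LocalHamiltonian|GLH|subsetState'` (2026-08-15): nothing in Mathlib; in the
tree only `Literature.MathematicalPhysics.QuantumLattice.localHamiltonian` (lattice interactions,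
unrelated instance format) and the two inlined route items.  Reused: `PromiseProblem.ofEncoding`
(Promise.lean), the `Bool` encodings (BoolEncodings.lean), `Pauli`/`pauliString`
(PauliExpansion.lean), `conjTranspose_pauliString` (PauliParseval.lean).
-/

noncomputable section

namespace Literature.Computability.QuantumComplexity

open Literature.Computability.Complexity

/-! ### Instances and their Boolean encoding -/

/-- A weighted Pauli term on `n` qubits: `((p, q), (x, z))` stands for the operator
`(p + q√2) • ⊗ᵢ σ(xᵢ, zᵢ)` (see `termWeight`, `termString`). [folklore] -/
abbrev GuidedPauliTerm (n : ℕ) : Type :=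
  (ℤ × ℤ) × ((Fin n → Bool) × (Fin n → Bool))

/-- The data of a guided Pauli-Hamiltonian instance on `n` qubits:
`(terms, (guide, (α, (β, D))))` — the weighted Pauli terms of `H`, the signed support list of the
guide `u`, and the threshold data (`a = α/(D+1)`, `b = β/(D+1)`). [folklore] -/
abbrev GuidedPauliData (n : ℕ) : Type :=
  List (GuidedPauliTerm n) × (List (Bool × (Fin n → Bool)) × (ℤ × ℤ × ℕ))

/-- Instances of the guided Pauli-Hamiltonian problem: a qubit number `n` together with data on
`n` qubits, `⟨n, (terms, (guide, (α, (β, D))))⟩`. [folklore] -/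
abbrev GuidedPauliInstance : Type :=
  Σ n : ℕ, GuidedPauliData n

/-- The Boolean encoding of instances: the dependent pair / pair / list combinators of
`BoolEncodings.lean` over the binary encodings of `ℤ`, bit vectors `Fin n → Bool`, `Bool` and `ℕ`
— literally the encoding inlined in route `NeedleThreshold`. [cite: AroraBarak2009, §0.1] -/
def guidedPauliEncoding : _root_.Computability.Encoding GuidedPauliInstance Bool :=
  _root_.Computability.Encoding.sigmaBool (F := GuidedPauliData) fun n : ℕ =>
    (((encodingIntBool.pairBool encodingIntBool).pairBool
        ((encodingBitVec n).pairBool (encodingBitVec n))).listBool).pairBool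
      (((_root_.Computability.encodingBoolBool.pairBool (encodingBitVec n)).listBool).pairBool
        (encodingIntBool.pairBool
          (encodingIntBool.pairBool _root_.Computability.encodingNatBool)))

/-! ### Hamiltonian, Pauli 1-norm and guiding vector of an instance -/

variable {n : ℕ}

/-- The Pauli letter with symplectic bits `(x, z)`: `(0,0) ↦ I`, `(1,0) ↦ X`, `(0,1) ↦ Z`,
`(1,1) ↦ Y` (so `σ(x,z) ∝ Xˣ Zᶻ`). [cite: AaronsonGottesman2004, §III] -/
def Pauli.ofXZ (x z : Bool) : Pauli :=
  if x then (if z then Pauli.Y else Pauli.X) else (if z then Pauli.Z else Pauli.I)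

/-- `σ(0,0) = I`. [folklore] -/
@[simp] theorem Pauli.ofXZ_false_false : Pauli.ofXZ false false = Pauli.I := rfl
/-- `σ(1,0) = X`. [folklore] -/
@[simp] theorem Pauli.ofXZ_true_false : Pauli.ofXZ true false = Pauli.X := rfl
/-- `σ(0,1) = Z`. [folklore] -/
@[simp] theorem Pauli.ofXZ_false_true : Pauli.ofXZ false true = Pauli.Z := rfl
/-- `σ(1,1) = Y`. [folklore] -/
@[simp] theorem Pauli.ofXZ_true_true : Pauli.ofXZ true true = Pauli.Y := rfl

/-- The real weight `p + q√2 ∈ ℤ[√2]` of a term `((p, q), (x, z))`. [folklore] -/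
def termWeight (t : GuidedPauliTerm n) : ℝ :=
  (t.1.1 : ℝ) + (t.1.2 : ℝ) * Real.sqrt 2

/-- The Pauli word `i ↦ σ(xᵢ, zᵢ)` of a term `((p, q), (x, z))`. [folklore] -/
def termString (t : GuidedPauliTerm n) : Fin n → Pauli :=
  fun i => Pauli.ofXZ (t.2.1 i) (t.2.2 i)

/-- The Hamiltonian of a term list: `H = Σ_t (p_t + q_t√2) • ⊗ᵢ σ(x_{t,i}, z_{t,i})`, a
`2ⁿ × 2ⁿ` complex matrix on the register `Fin n → Bool`. [folklore] -/
def guidedPauliHamiltonian (terms : List (GuidedPauliTerm n)) :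
    Matrix (Fin n → Bool) (Fin n → Bool) ℂ :=
  (terms.map fun t => ((termWeight t : ℝ) : ℂ) • pauliString (termString t)).sum

/-- The **Pauli 1-norm** `Λ = Σ_t |p_t + q_t√2|` of a term list — the parameter `κ = Σ ‖H_i‖` of
the `(s, κ)`-decomposition `H = Σ H_i` into (unit-norm) weighted Pauli strings; energies of the
problem are measured relative to `Λ`. [cite: Gall2024, §1.4 and §2.3] -/
def pauliOneNorm (terms : List (GuidedPauliTerm n)) : ℝ :=
  (terms.map fun t => |termWeight t|).sum

/-- The **signed subset state** of a guide list: `u = Σ_{(s, x) ∈ guide} (−1)^s e_x`, i.e.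
`u y = Σ_{(s, x) ∈ guide, x = y} (−1)^s` (unnormalised).  For distinct `x`'s and all signs `+`
this is `√|S|` times the subset state `|S|^{-1/2} Σ_{w ∈ S} |w⟩` of the semi-classical guiding
vectors. [cite: GharibianLegall2022, §1.2 (semi-classical states)] -/
def signedSubsetState (guide : List (Bool × (Fin n → Bool))) : (Fin n → Bool) → ℂ :=
  fun y => (guide.map fun g => if g.2 = y then (if g.1 then (-1 : ℂ) else 1) else 0).sum

/-! ### The two sides of the promise -/

/-- YES data for precision schedule `g` and overlap `χ₀`: `0 < Λ`, the relative gap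
`(D+1) ≤ (β − α) g(n)`, the guide `u ≠ 0` (as `0 < ‖u‖²`), and some eigenpair `H v = l v`,
`v ≠ 0`, with `l (D+1) ≤ α Λ` (energy `≤ aΛ`, `a = α/(D+1)`) and
`χ₀² ‖u‖² ‖v‖² ≤ |⟨u, v⟩|²`. Variant of the YES side of `GLH*(k, a, b, δ)` (there: `λ_H ≤ a`,
`‖Π_H u‖ ≥ δ`). [cite: GharibianLegall2022, §1.2 (GLH*(k,a,b,δ))] -/
def IsGuidedPauliYes (g : ℕ → ℝ) (χ₀ : ℝ) (n : ℕ) (terms : List (GuidedPauliTerm n))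
    (guide : List (Bool × (Fin n → Bool))) (α β : ℤ) (D : ℕ) : Prop :=
  0 < pauliOneNorm terms ∧
    ((D : ℝ) + 1) ≤ ((β : ℝ) - α) * g n ∧
    0 < ∑ y, ‖signedSubsetState guide y‖ ^ 2 ∧
    ∃ (l : ℝ) (v : (Fin n → Bool) → ℂ), v ≠ 0 ∧
      (guidedPauliHamiltonian terms).mulVec v = (l : ℂ) • v ∧
      l * ((D : ℝ) + 1) ≤ (α : ℝ) * pauliOneNorm terms ∧
      χ₀ ^ 2 * (∑ y, ‖signedSubsetState guide y‖ ^ 2) * (∑ y, ‖v y‖ ^ 2) ≤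
        ‖∑ y, star (signedSubsetState guide y) * v y‖ ^ 2

/-- NO data for precision schedule `g`: `0 < Λ`, the relative gap `(D+1) ≤ (β − α) g(n)`, and
every eigenpair `H v = l v`, `v ≠ 0`, has `β Λ ≤ l (D+1)` (spectrum `≥ bΛ`, `b = β/(D+1)`); no
condition on the guide. Variant of the NO side of `GLH*(k, a, b, δ)` (there: `λ_H ≥ b`).
[cite: GharibianLegall2022, §1.2 (GLH*(k,a,b,δ))] -/
def IsGuidedPauliNo (g : ℕ → ℝ) (n : ℕ) (terms : List (GuidedPauliTerm n)) (α β : ℤ) (D : ℕ) :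
    Prop :=
  0 < pauliOneNorm terms ∧
    ((D : ℝ) + 1) ≤ ((β : ℝ) - α) * g n ∧
    ∀ (l : ℝ) (v : (Fin n → Bool) → ℂ), v ≠ 0 →
      (guidedPauliHamiltonian terms).mulVec v = (l : ℂ) • v →
      (β : ℝ) * pauliOneNorm terms ≤ l * ((D : ℝ) + 1)

/-- The YES instances for schedule `g` and overlap `χ₀`.
[cite: GharibianLegall2022, §1.2 (GLH*(k,a,b,δ))] -/
def guidedPauliYesSet (g : ℕ → ℝ) (χ₀ : ℝ) : Set GuidedPauliInstance :=
  {I | ∃ (n : ℕ) (terms : List (GuidedPauliTerm n)) (guide : List (Bool × (Fin n → Bool)))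
      (α β : ℤ) (D : ℕ), I = ⟨n, (terms, (guide, (α, (β, D))))⟩ ∧
      IsGuidedPauliYes g χ₀ n terms guide α β D}

/-- The NO instances for schedule `g`. [cite: GharibianLegall2022, §1.2 (GLH*(k,a,b,δ))] -/
def guidedPauliNoSet (g : ℕ → ℝ) : Set GuidedPauliInstance :=
  {I | ∃ (n : ℕ) (terms : List (GuidedPauliTerm n)) (guide : List (Bool × (Fin n → Bool)))
      (α β : ℤ) (D : ℕ), I = ⟨n, (terms, (guide, (α, (β, D))))⟩ ∧
      IsGuidedPauliNo g n terms α β D}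

/-! ### The promise problems -/

/-- The guided Pauli-Hamiltonian promise problem with relative precision schedule `1/g(n)` and
overlap `χ₀`: `PromiseProblem.ofEncoding guidedPauliEncoding (YES) (NO)`.
[cite: GharibianLegall2022, §1.2 (GLH*(k,a,b,δ))] -/
def guidedPauliProblem (g : ℕ → ℝ) (χ₀ : ℝ) : PromiseProblem :=
  PromiseProblem.ofEncoding guidedPauliEncoding (guidedPauliYesSet g χ₀) (guidedPauliNoSet g)

/-- **`GLH(K, χ₀)`** — the guided Pauli-Hamiltonian problem of route `NeedleThreshold`: schedule
`g(n) = K ⌊log₂ n⌋² + 1`, i.e. relative promise gap `b − a ≥ 1/(K ⌊log₂ n⌋² + 1)`, overlap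
`χ₀`.  This is `GLH*(k, a, b, δ)` with the deltas (i)–(v) of the module docstring.
[cite: GharibianLegall2022, §1.2 (GLH*(k,a,b,δ)) and Thm 2] -/
def guidedPauliHamiltonianProblem (K : ℕ) (χ₀ : ℝ) : PromiseProblem :=
  guidedPauliProblem (fun n => (K : ℝ) * (Nat.log 2 n : ℝ) ^ 2 + 1) χ₀

/-- The inverse-polynomial-precision sibling: schedule `g(n) = n^c + c`, i.e. relative promise
gap `b − a ≥ 1/(n^c + c)` — the regime `b − a = Ω(1/poly(n))` of the printed hardness theorem.
[cite: GharibianLegall2022, §1.2 (GLH*(k,a,b,δ)) and Thm 2] -/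
def guidedPauliHamiltonianProblem' (c : ℕ) (χ₀ : ℝ) : PromiseProblem :=
  guidedPauliProblem (fun n => (n : ℝ) ^ c + c) χ₀

/-! ### Unfolding, membership of explicit instances, disjointness of the promise -/

/-- `guidedPauliHamiltonianProblem K χ₀` is, definitionally, the promise problem inlined verbatim
in the route items `GuidedHardness` and `NeedleBPP` of `NeedleThreshold` (QuantumAdvantage).
[folklore] -/
theorem guidedPauliHamiltonianProblem_eq (K : ℕ) (χ₀ : ℝ) :
    guidedPauliHamiltonianProblem K χ₀ =
      Literature.Computability.Complexity.PromiseProblem.ofEncoding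
        (Computability.Encoding.sigmaBool
          (F := fun n : ℕ => List ((ℤ × ℤ) × ((Fin n → Bool) × (Fin n → Bool))) ×
            (List (Bool × (Fin n → Bool)) × (ℤ × ℤ × ℕ)))
          (fun n : ℕ => (((Literature.Computability.Complexity.encodingIntBool.pairBool
            Literature.Computability.Complexity.encodingIntBool).pairBool
            ((Literature.Computability.Complexity.encodingBitVec n).pairBool
            (Literature.Computability.Complexity.encodingBitVec n))).listBool).pairBool
            (((Computability.encodingBoolBool.pairBool
            (Literature.Computability.Complexity.encodingBitVec n)).listBool).pairBool
            (Literature.Computability.Complexity.encodingIntBool.pairBool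
            (Literature.Computability.Complexity.encodingIntBool.pairBool
            Computability.encodingNatBool)))))
        {I | ∃ (n : ℕ) (terms : List ((ℤ × ℤ) × ((Fin n → Bool) × (Fin n → Bool))))
          (guide : List (Bool × (Fin n → Bool))) (α β : ℤ) (D : ℕ),
          I = ⟨n, (terms, (guide, (α, (β, D))))⟩ ∧
          let H : Matrix (Fin n → Bool) (Fin n → Bool) ℂ := (terms.map fun t =>
            ((((t.1.1 : ℝ) + (t.1.2 : ℝ) * Real.sqrt 2 : ℝ) : ℂ) •
            Literature.Computability.QuantumComplexity.pauliString fun i => if t.2.1 i then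
            (if t.2.2 i then Literature.Computability.QuantumComplexity.Pauli.Y else
            Literature.Computability.QuantumComplexity.Pauli.X) else (if t.2.2 i then
            Literature.Computability.QuantumComplexity.Pauli.Z else
            Literature.Computability.QuantumComplexity.Pauli.I))).sum;
          let Λ : ℝ := (terms.map fun t => |(t.1.1 : ℝ) + (t.1.2 : ℝ) * Real.sqrt 2|).sum;
          let u : (Fin n → Bool) → ℂ := fun y =>
            (guide.map fun g => if g.2 = y then (if g.1 then (-1 : ℂ) else 1) else 0).sum;
          0 < Λ ∧ ((D : ℝ) + 1) ≤ ((β : ℝ) - α) * (((K : ℕ) : ℝ) * (Nat.log 2 n : ℝ) ^ 2 + 1) ∧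
          0 < ∑ y, ‖u y‖ ^ 2 ∧ ∃ (l : ℝ) (v : (Fin n → Bool) → ℂ), v ≠ 0 ∧
          H.mulVec v = (l : ℂ) • v ∧ l * ((D : ℝ) + 1) ≤ (α : ℝ) * Λ ∧
          (χ₀ : ℝ) ^ 2 * (∑ y, ‖u y‖ ^ 2) * (∑ y, ‖v y‖ ^ 2) ≤ ‖∑ y, star (u y) * v y‖ ^ 2}
        {I | ∃ (n : ℕ) (terms : List ((ℤ × ℤ) × ((Fin n → Bool) × (Fin n → Bool))))
          (guide : List (Bool × (Fin n → Bool))) (α β : ℤ) (D : ℕ),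
          I = ⟨n, (terms, (guide, (α, (β, D))))⟩ ∧
          let H : Matrix (Fin n → Bool) (Fin n → Bool) ℂ := (terms.map fun t =>
            ((((t.1.1 : ℝ) + (t.1.2 : ℝ) * Real.sqrt 2 : ℝ) : ℂ) •
            Literature.Computability.QuantumComplexity.pauliString fun i => if t.2.1 i then
            (if t.2.2 i then Literature.Computability.QuantumComplexity.Pauli.Y else
            Literature.Computability.QuantumComplexity.Pauli.X) else (if t.2.2 i then
            Literature.Computability.QuantumComplexity.Pauli.Z else
            Literature.Computability.QuantumComplexity.Pauli.I))).sum;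
          let Λ : ℝ := (terms.map fun t => |(t.1.1 : ℝ) + (t.1.2 : ℝ) * Real.sqrt 2|).sum;
          0 < Λ ∧ ((D : ℝ) + 1) ≤ ((β : ℝ) - α) * (((K : ℕ) : ℝ) * (Nat.log 2 n : ℝ) ^ 2 + 1) ∧
          ∀ (l : ℝ) (v : (Fin n → Bool) → ℂ), v ≠ 0 → H.mulVec v = (l : ℂ) • v →
          (β : ℝ) * Λ ≤ l * ((D : ℝ) + 1)} :=
  rfl

/-- The YES side of `guidedPauliProblem g χ₀` is the encoded YES set. [folklore] -/
@[simp] theorem yes_guidedPauliProblem (g : ℕ → ℝ) (χ₀ : ℝ) :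
    (guidedPauliProblem g χ₀).yes = guidedPauliEncoding.toLanguage (guidedPauliYesSet g χ₀) :=
  rfl

/-- The NO side of `guidedPauliProblem g χ₀` is the encoded NO set. [folklore] -/
@[simp] theorem no_guidedPauliProblem (g : ℕ → ℝ) (χ₀ : ℝ) :
    (guidedPauliProblem g χ₀).no = guidedPauliEncoding.toLanguage (guidedPauliNoSet g) :=
  rfl

/-- An explicit instance is a YES instance iff its data satisfies `IsGuidedPauliYes`.
[folklore] -/
theorem mk_mem_guidedPauliYesSet_iff {g : ℕ → ℝ} {χ₀ : ℝ} {n : ℕ}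
    {terms : List (GuidedPauliTerm n)} {guide : List (Bool × (Fin n → Bool))} {α β : ℤ} {D : ℕ} :
    (⟨n, (terms, (guide, (α, (β, D))))⟩ : GuidedPauliInstance) ∈ guidedPauliYesSet g χ₀ ↔
      IsGuidedPauliYes g χ₀ n terms guide α β D := by
  refine ⟨?_, fun h => ⟨n, terms, guide, α, β, D, rfl, h⟩⟩
  rintro ⟨n', terms', guide', α', β', D', ⟨⟩, h'⟩
  exact h'

/-- An explicit instance is a NO instance iff its data satisfies `IsGuidedPauliNo`.
[folklore] -/
theorem mk_mem_guidedPauliNoSet_iff {g : ℕ → ℝ} {n : ℕ}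
    {terms : List (GuidedPauliTerm n)} {guide : List (Bool × (Fin n → Bool))} {α β : ℤ} {D : ℕ} :
    (⟨n, (terms, (guide, (α, (β, D))))⟩ : GuidedPauliInstance) ∈ guidedPauliNoSet g ↔
      IsGuidedPauliNo g n terms α β D := by
  refine ⟨?_, fun h => ⟨n, terms, guide, α, β, D, rfl, h⟩⟩
  rintro ⟨n', terms', guide', α', β', D', ⟨⟩, h'⟩
  exact h'

/-- YES data and NO data are incompatible when `0 ≤ g n`: the YES eigenpair `(l, v)` gives
`β Λ ≤ l (D+1) ≤ α Λ`, whereas `Λ > 0` and `0 < D + 1 ≤ (β − α) g(n)` force `α < β`. [folklore] -/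
theorem IsGuidedPauliYes.not_isGuidedPauliNo {g : ℕ → ℝ} {χ₀ : ℝ} {n : ℕ}
    {terms : List (GuidedPauliTerm n)} {guide : List (Bool × (Fin n → Bool))} {α β : ℤ} {D : ℕ}
    (hg : 0 ≤ g n) (hyes : IsGuidedPauliYes g χ₀ n terms guide α β D) :
    ¬ IsGuidedPauliNo g n terms α β D := by
  rintro ⟨-, -, hall⟩
  obtain ⟨hΛ, hgap, -, l, v, hv, hHv, hl, -⟩ := hyes
  have hβ : (β : ℝ) * pauliOneNorm terms ≤ l * ((D : ℝ) + 1) := hall l v hv hHv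
  have hD : (0 : ℝ) < (D : ℝ) + 1 := by positivity
  have hβα : (0 : ℝ) < (β : ℝ) - α := by
    by_contra h
    nlinarith [mul_nonneg (neg_nonneg.2 (not_lt.1 h)) hg, hD, hgap]
  nlinarith [mul_pos hβα hΛ, hβ, hl]

/-- For a non-negative schedule the YES and NO instance sets are disjoint. [folklore] -/
theorem disjoint_guidedPauliYesSet_guidedPauliNoSet {g : ℕ → ℝ} (hg : ∀ n, 0 ≤ g n) (χ₀ : ℝ) :
    Disjoint (guidedPauliYesSet g χ₀) (guidedPauliNoSet g) := by
  refine Set.disjoint_left.2 ?_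
  rintro ⟨n, terms, guide, α, β, D⟩ hyes hno
  rw [mk_mem_guidedPauliYesSet_iff] at hyes
  rw [mk_mem_guidedPauliNoSet_iff] at hno
  exact hyes.not_isGuidedPauliNo (hg n) hno

/-- For a non-negative schedule the guided Pauli-Hamiltonian problem is a disjoint promise
problem. [folklore] -/
theorem guidedPauliProblem_disjoint {g : ℕ → ℝ} (hg : ∀ n, 0 ≤ g n) (χ₀ : ℝ) :
    (guidedPauliProblem g χ₀).Disjoint :=
  PromiseProblem.disjoint_ofEncoding _ (disjoint_guidedPauliYesSet_guidedPauliNoSet hg χ₀)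

/-- `GLH(K, χ₀)` is a disjoint promise problem. [folklore] -/
theorem guidedPauliHamiltonianProblem_disjoint (K : ℕ) (χ₀ : ℝ) :
    (guidedPauliHamiltonianProblem K χ₀).Disjoint :=
  guidedPauliProblem_disjoint (fun n => by positivity) χ₀

/-- The inverse-polynomial sibling is a disjoint promise problem. [folklore] -/
theorem guidedPauliHamiltonianProblem'_disjoint (c : ℕ) (χ₀ : ℝ) :
    (guidedPauliHamiltonianProblem' c χ₀).Disjoint :=
  guidedPauliProblem_disjoint (fun n => by positivity) χ₀

/-! ### Elementary properties of the Hamiltonian, the 1-norm and the guide -/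

/-- The empty term list has Hamiltonian `0`. [folklore] -/
@[simp] theorem guidedPauliHamiltonian_nil :
    guidedPauliHamiltonian ([] : List (GuidedPauliTerm n)) = 0 := rfl

/-- The Hamiltonian of `t :: terms`. [folklore] -/
theorem guidedPauliHamiltonian_cons (t : GuidedPauliTerm n) (terms : List (GuidedPauliTerm n)) :
    guidedPauliHamiltonian (t :: terms) =
      ((termWeight t : ℝ) : ℂ) • pauliString (termString t) + guidedPauliHamiltonian terms := by
  simp [guidedPauliHamiltonian]

/-- The empty term list has Pauli 1-norm `0`. [folklore] -/
@[simp] theorem pauliOneNorm_nil : pauliOneNorm ([] : List (GuidedPauliTerm n)) = 0 := rfl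

/-- The Pauli 1-norm of `t :: terms`. [folklore] -/
theorem pauliOneNorm_cons (t : GuidedPauliTerm n) (terms : List (GuidedPauliTerm n)) :
    pauliOneNorm (t :: terms) = |termWeight t| + pauliOneNorm terms := by
  simp [pauliOneNorm]

/-- The Pauli 1-norm is non-negative. [folklore] -/
theorem pauliOneNorm_nonneg (terms : List (GuidedPauliTerm n)) : 0 ≤ pauliOneNorm terms := by
  induction terms with
  | nil => simp
  | cons t terms ih => rw [pauliOneNorm_cons]; positivity

/-- The empty guide is the zero vector. [folklore] -/
@[simp] theorem signedSubsetState_nil :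
    signedSubsetState ([] : List (Bool × (Fin n → Bool))) = 0 := rfl

/-- The guide of `(s, x) :: guide` is `(−1)^s e_x` plus the guide of `guide`. [folklore] -/
theorem signedSubsetState_cons_apply (s : Bool) (x : Fin n → Bool)
    (guide : List (Bool × (Fin n → Bool))) (y : Fin n → Bool) :
    signedSubsetState ((s, x) :: guide) y =
      (if x = y then (if s then (-1 : ℂ) else 1) else 0) + signedSubsetState guide y := by
  simp [signedSubsetState]

/-- The Hamiltonian is Hermitian: real weights on Hermitian Pauli strings. [folklore] -/
theorem isHermitian_guidedPauliHamiltonian (terms : List (GuidedPauliTerm n)) :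
    (guidedPauliHamiltonian terms).IsHermitian := by
  induction terms with
  | nil => rw [guidedPauliHamiltonian_nil]; exact Matrix.isHermitian_zero
  | cons t terms ih =>
    rw [guidedPauliHamiltonian_cons]
    refine Matrix.IsHermitian.add ?_ ih
    show Matrix.conjTranspose _ = _
    rw [Matrix.conjTranspose_smul, conjTranspose_pauliString, Complex.star_def,
      Complex.conj_ofReal]

end Literature.Computability.QuantumComplexity
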